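import Mathlib
import HarnessLib
import Summits.HubbardSuperconductivity.HubbardSuperconductivity.Theorems.KLProgrammeKLRegimeEngineV8TwoLegGridSpectator
import Summits.HubbardSuperconductivity.HubbardSuperconductivity.Theorems.KLProgrammeKLRegimeTwoVolumeSectorPreimageMap
import Summits.HubbardSuperconductivity.HubbardSuperconductivity.Theorems.KLProgrammeKLRegimeEngineE4ScaleDoor
import Literature.MathematicalPhysics.QuantumLattice.HubbardSectorAnalysisFactorisation

/-!
# Route `KLProgramme` — ENGINE child gen 8 (stmt-HubbardSuperconductivity-20437 `KLRegimeEngineV17F2`), class #7 in GRID currency ((Y′)-GRID), deliverable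
# W3 «plain-leg m = 2 read-out pass»: the sector-spectator door for an ARBITRARY SPECTATOR FAMILY `p : ρ → GridLeg` — in particular ALL grid legs at once
# (`ρ = GridLeg (GridPoint L 4M)`, `p = id`), the form in which a pinned `L¹` output sum is ONE output sum of ONE step — and the weight on the enlarged
# label set (cell gate-hubbard-kl, seat hubbard-kl-k3c2-p3 g7)

`…TwoLegGridSpectatorSector` pins the output string itself (`ρ = Fin m`): one enlarged algebra per string, good for pointwise identities.  To bound a
PINNED `L¹` SUM over the free output leg inside one step one takes a spectator for EVERY grid leg: the Literature door (`GrassmannSpectatorReadout`) allows any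
`ρ`, `p : ρ → Γ_grid`, `a : Fin m → ρ`, and reads `kernel_m (W_{j+1}[K] − W_j[K]) (p ∘ a)` as the kernel at `inr ∘ a` of the step in
`(SpaceTimeIdx L M × SectorLeg N) ⊕ ρ` with covariance `fromBlocks (S(F̃)ᵀ C^K_{(Λ_{j+1},Λ_j]} S(F̃)) 0 0 0` on `Ψ_p W_j[K]` (`Ψ_p = map (toLin' (fromRows ((ε•E(F))S_{4M}) [p b = q]))`).

* **`kernel_gridEffAction_succ_sub_eq_spectator_family`** — the three-piece split in sector-spectator form for any `(ρ, p, a)`;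
* `kernel_gridSpectatorFamilyVertex_inl` (`= kernel_m (sectorPreimage β F 𝒱⁽ʲ⁾[K]) k`), `…_inr` (`= kernel_m W_j[K] (p ∘ a)`), `…_eq_zero_of_repeat`;
* THE WEIGHT: **`isTreeWeight_klScaleWt_spectator`** — `S ↦ klScaleWt L M β n (S.image (Sum.elim (latticeLegPos 4M) (gridLegPos ∘ p)))` is a tree weight on
  `(SpaceTimeIdx × SectorLeg Ns) ⊕ ρ` (`IsTreeWeight.comap`); `image_sumElim_inr_comp` / `image_sumElim_inl_comp` — on an all-spectator string `inr ∘ a` it is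
  LITERALLY the weight `klScaleWt … ((univ.image (p ∘ a)).image gridLegPos)` of the slot of `twoLegGridMomentsAt_of_wtIncrements`, on an all-sector string `inl ∘ k`
  the tower's `klWtPinnedSum` weight `klScaleWt … ((univ.image k).image (latticeLegPos 4M))`.

RESIDUAL (the analytic half, not here): the SUPPORT-AWARE G1-L (internal slots summed over `supp C = inl`, output slots prescribed `inr`) in this algebra, fed with
the anchored mixed norms of `Ψ_p W_j[K]` (≤ 2 plain legs) and the zero-extended covariance data (`GrassmannGramFormZeroExtension`).
Exact identities + one `IsTreeWeight`; no estimate, no definition; nothing about the model's sizes is asserted; nothing asserts superconductivity.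
References: BGM 2006 §2.2 (2.12), §2.7 (2.66)–(2.71) [cite: BenfattoGiulianiMastropietro2006]; Salmhofer 1999 App. B.2 (B.23)–(B.25) [cite: Salmhofer1999].
-/

noncomputable section

namespace Summit.HubbardSuperconductivity.HubbardSuperconductivity.Theorems.EngineV8

set_option linter.dupNamespace false -- summit = problem name (single-conjunct summit), D-0017

open Real Finset Literature.MathematicalPhysics.QuantumLattice Literature.Probability.LatticeModels
open Literature.Probability.LatticeModels.BattleFederbush GrassmannAlgebra
open Summit.HubbardSuperconductivity.HubbardSuperconductivity.Theorems.KLRegimeSplit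
open Summit.HubbardSuperconductivity.HubbardSuperconductivity.Theorems.KLProgrammeLegKernels
open Summit.HubbardSuperconductivity.HubbardSuperconductivity.Theorems.TwoVolumeDefect

section Model

variable {L M : ℕ} [NeZero L] [NeZero M] {N : ℕ} {ρ : Type*}

/-- **THE GRID INCREMENT IN SECTOR-SPECTATOR FORM, ARBITRARY SPECTATOR FAMILY** (`β ≠ 0`, `Z^K_{Λ_j} ≠ 0`, `F̃F = F`, plateau of `F` over the slice; any `ρ`,
`p : ρ → GridLeg`, `a : Fin m → ρ`): with `Mb = (ε_x • E(F)) S_{4M}`, `D = S(F̃)ᵀ C^K_{(Λ_{j+1},Λ_j]} S(F̃)`, `B = fromBlocks D 0 0 0`, `Ψ_p = map (toLin' (fromRows Mb [p b = q]))`,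
`kernel_m (W_{j+1}[K] − W_j[K]) (p ∘ a) = kernel_m (Δ_B (Ψ_p W_j)) (inr ∘ a) + kernel_m (e^{Δ_B}(Ψ_p W_j) − Ψ_p W_j − Δ_B(Ψ_p W_j)) (inr ∘ a)
+ kernel_m (effAction B (Ψ_p W_j) − e^{Δ_B}(Ψ_p W_j)) (inr ∘ a)` — with `ρ = GridLeg`, `p = id` every output string at once, in ONE algebra. -/
theorem kernel_gridEffAction_succ_sub_eq_spectator_family [Fintype ρ] {β : ℝ} (hβ : β ≠ 0) (U μ : ℝ) (K : TrigPolyC4v) (j : ℕ)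
    (hZ : hubbardEffPartitionFnCT L M β U μ 0 K (klScale klE0 j) ≠ 0) (F Ft : Fin N → FreqMomentum L M → ℂ) (hFF : ∀ ω k, Ft ω k * F ω k = F ω k)
    (hCpl : ∀ X Y, hubbardCovSliceCT L M β μ 0 K (klScale klE0 (j + 1)) (klScale klE0 j) X Y ≠ 0 → ∑ ω, F ω X.1.1 = 1 ∧ ∑ ω, F ω Y.1.1 = 1)
    (p : ρ → GridLeg (GridPoint L (2 * (2 * M)))) (m : ℕ) (a : Fin m → ρ) :
    kernel ℂ
        (effAction ℂ ((hubbardGridSub L M β (2 * (2 * M))).transpose *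
            hubbardCovAboveCT L M β μ 0 K (klScale klE0 (j + 1)) * hubbardGridSub L M β (2 * (2 * M)))
          (hubbardGridInteraction L (2 * (2 * M)) β U + hubbardGridCounterQuadratic L (2 * (2 * M)) β K) -
        effAction ℂ ((hubbardGridSub L M β (2 * (2 * M))).transpose *
            hubbardCovAboveCT L M β μ 0 K (klScale klE0 j) * hubbardGridSub L M β (2 * (2 * M)))
          (hubbardGridInteraction L (2 * (2 * M)) β U + hubbardGridCounterQuadratic L (2 * (2 * M)) β K)) m (p ∘ a) =
      kernel ℂ (grassmannLaplacian ℂ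
          (Matrix.fromBlocks ((sectorSubMatrix L M β Ft).transpose * hubbardCovSliceCT L M β μ 0 K (klScale klE0 (j + 1)) (klScale klE0 j) *
              sectorSubMatrix L M β Ft) (0 : Matrix (SpaceTimeIdx L M × SectorLeg N) ρ ℂ)
            (0 : Matrix ρ (SpaceTimeIdx L M × SectorLeg N) ℂ) (0 : Matrix ρ ρ ℂ))
          (ExteriorAlgebra.map (Matrix.toLin' (Matrix.fromRows
              ((((imagTimeWeight β M : ℝ) : ℂ)) • sectorAnalysisMatrix L M β F * hubbardGridSub L M β (2 * (2 * M)))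
              (Matrix.of fun b q => if p b = q then (1 : ℂ) else 0)))
            (effAction ℂ ((hubbardGridSub L M β (2 * (2 * M))).transpose *
                hubbardCovAboveCT L M β μ 0 K (klScale klE0 j) * hubbardGridSub L M β (2 * (2 * M)))
              (hubbardGridInteraction L (2 * (2 * M)) β U + hubbardGridCounterQuadratic L (2 * (2 * M)) β K)))) m (Sum.inr ∘ a) +
      kernel ℂ (gaussConv ℂ
            (Matrix.fromBlocks ((sectorSubMatrix L M β Ft).transpose * hubbardCovSliceCT L M β μ 0 K (klScale klE0 (j + 1)) (klScale klE0 j) *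
                sectorSubMatrix L M β Ft) (0 : Matrix (SpaceTimeIdx L M × SectorLeg N) ρ ℂ)
              (0 : Matrix ρ (SpaceTimeIdx L M × SectorLeg N) ℂ) (0 : Matrix ρ ρ ℂ))
            (ExteriorAlgebra.map (Matrix.toLin' (Matrix.fromRows
                ((((imagTimeWeight β M : ℝ) : ℂ)) • sectorAnalysisMatrix L M β F * hubbardGridSub L M β (2 * (2 * M)))
                (Matrix.of fun b q => if p b = q then (1 : ℂ) else 0)))
              (effAction ℂ ((hubbardGridSub L M β (2 * (2 * M))).transpose *
                  hubbardCovAboveCT L M β μ 0 K (klScale klE0 j) * hubbardGridSub L M β (2 * (2 * M)))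
                (hubbardGridInteraction L (2 * (2 * M)) β U + hubbardGridCounterQuadratic L (2 * (2 * M)) β K))) -
          ExteriorAlgebra.map (Matrix.toLin' (Matrix.fromRows
              ((((imagTimeWeight β M : ℝ) : ℂ)) • sectorAnalysisMatrix L M β F * hubbardGridSub L M β (2 * (2 * M)))
              (Matrix.of fun b q => if p b = q then (1 : ℂ) else 0)))
            (effAction ℂ ((hubbardGridSub L M β (2 * (2 * M))).transpose *
                hubbardCovAboveCT L M β μ 0 K (klScale klE0 j) * hubbardGridSub L M β (2 * (2 * M)))
              (hubbardGridInteraction L (2 * (2 * M)) β U + hubbardGridCounterQuadratic L (2 * (2 * M)) β K)) -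
          grassmannLaplacian ℂ
            (Matrix.fromBlocks ((sectorSubMatrix L M β Ft).transpose * hubbardCovSliceCT L M β μ 0 K (klScale klE0 (j + 1)) (klScale klE0 j) *
                sectorSubMatrix L M β Ft) (0 : Matrix (SpaceTimeIdx L M × SectorLeg N) ρ ℂ)
              (0 : Matrix ρ (SpaceTimeIdx L M × SectorLeg N) ℂ) (0 : Matrix ρ ρ ℂ))
            (ExteriorAlgebra.map (Matrix.toLin' (Matrix.fromRows
                ((((imagTimeWeight β M : ℝ) : ℂ)) • sectorAnalysisMatrix L M β F * hubbardGridSub L M β (2 * (2 * M)))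
                (Matrix.of fun b q => if p b = q then (1 : ℂ) else 0)))
              (effAction ℂ ((hubbardGridSub L M β (2 * (2 * M))).transpose *
                  hubbardCovAboveCT L M β μ 0 K (klScale klE0 j) * hubbardGridSub L M β (2 * (2 * M)))
                (hubbardGridInteraction L (2 * (2 * M)) β U + hubbardGridCounterQuadratic L (2 * (2 * M)) β K)))) m (Sum.inr ∘ a) +
      kernel ℂ (effAction ℂ
            (Matrix.fromBlocks ((sectorSubMatrix L M β Ft).transpose * hubbardCovSliceCT L M β μ 0 K (klScale klE0 (j + 1)) (klScale klE0 j) *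
                sectorSubMatrix L M β Ft) (0 : Matrix (SpaceTimeIdx L M × SectorLeg N) ρ ℂ)
              (0 : Matrix ρ (SpaceTimeIdx L M × SectorLeg N) ℂ) (0 : Matrix ρ ρ ℂ))
            (ExteriorAlgebra.map (Matrix.toLin' (Matrix.fromRows
                ((((imagTimeWeight β M : ℝ) : ℂ)) • sectorAnalysisMatrix L M β F * hubbardGridSub L M β (2 * (2 * M)))
                (Matrix.of fun b q => if p b = q then (1 : ℂ) else 0)))
              (effAction ℂ ((hubbardGridSub L M β (2 * (2 * M))).transpose *
                  hubbardCovAboveCT L M β μ 0 K (klScale klE0 j) * hubbardGridSub L M β (2 * (2 * M)))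
                (hubbardGridInteraction L (2 * (2 * M)) β U + hubbardGridCounterQuadratic L (2 * (2 * M)) β K))) -
          gaussConv ℂ
            (Matrix.fromBlocks ((sectorSubMatrix L M β Ft).transpose * hubbardCovSliceCT L M β μ 0 K (klScale klE0 (j + 1)) (klScale klE0 j) *
                sectorSubMatrix L M β Ft) (0 : Matrix (SpaceTimeIdx L M × SectorLeg N) ρ ℂ)
              (0 : Matrix ρ (SpaceTimeIdx L M × SectorLeg N) ℂ) (0 : Matrix ρ ρ ℂ))
            (ExteriorAlgebra.map (Matrix.toLin' (Matrix.fromRows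
                ((((imagTimeWeight β M : ℝ) : ℂ)) • sectorAnalysisMatrix L M β F * hubbardGridSub L M β (2 * (2 * M)))
                (Matrix.of fun b q => if p b = q then (1 : ℂ) else 0)))
              (effAction ℂ ((hubbardGridSub L M β (2 * (2 * M))).transpose *
                  hubbardCovAboveCT L M β μ 0 K (klScale klE0 j) * hubbardGridSub L M β (2 * (2 * M)))
                (hubbardGridInteraction L (2 * (2 * M)) β U + hubbardGridCounterQuadratic L (2 * (2 * M)) β K)))) m (Sum.inr ∘ a) := by
  set Mb := (((imagTimeWeight β M : ℝ) : ℂ)) • sectorAnalysisMatrix L M β F * hubbardGridSub L M β (2 * (2 * M)) with hMb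
  set D := (sectorSubMatrix L M β Ft).transpose * hubbardCovSliceCT L M β μ 0 K (klScale klE0 (j + 1)) (klScale klE0 j) * sectorSubMatrix L M β Ft
    with hD
  set W := effAction ℂ ((hubbardGridSub L M β (2 * (2 * M))).transpose *
      hubbardCovAboveCT L M β μ 0 K (klScale klE0 j) * hubbardGridSub L M β (2 * (2 * M)))
    (hubbardGridInteraction L (2 * (2 * M)) β U + hubbardGridCounterQuadratic L (2 * (2 * M)) β K) with hW
  have hfac : (hubbardGridSub L M β (2 * (2 * M))).transpose * hubbardCovSliceCT L M β μ 0 K (klScale klE0 (j + 1)) (klScale klE0 j) *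
      hubbardGridSub L M β (2 * (2 * M)) = Mb.transpose * D * Mb := by
    rw [hMb, hD]; exact (smul_sectorAnalysis_factorisation hβ F Ft hFF _ hCpl _).symm
  rw [kernel_gridEffAction_succ_sub_eq hβ U μ K j hZ m (p ∘ a), ← hW, hfac, kernel_grassmannLaplacian_eq_spectator ℂ Mb D p W m a,
    kernel_gaussConv_sub_sub_laplacian_eq_spectator ℂ Mb D p W m a, kernel_effAction_sub_gaussConv_eq_spectator ℂ Mb D p W m a]

/-- **The sector legs of the spectator vertex are those of `sectorPreimage β F 𝒱⁽ʲ⁾[K]`** (any spectator family). -/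
theorem kernel_gridSpectatorFamilyVertex_inl {β : ℝ} (hβ : β ≠ 0) (U μ : ℝ) (K : TrigPolyC4v) (j : ℕ) (F : Fin N → FreqMomentum L M → ℂ)
    (p : ρ → GridLeg (GridPoint L (2 * (2 * M)))) (m : ℕ) (k : Fin m → SpaceTimeIdx L M × SectorLeg N) :
    kernel ℂ (ExteriorAlgebra.map (Matrix.toLin' (Matrix.fromRows
          ((((imagTimeWeight β M : ℝ) : ℂ)) • sectorAnalysisMatrix L M β F * hubbardGridSub L M β (2 * (2 * M)))
          (Matrix.of fun b q => if p b = q then (1 : ℂ) else 0)))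
        (effAction ℂ ((hubbardGridSub L M β (2 * (2 * M))).transpose *
            hubbardCovAboveCT L M β μ 0 K (klScale klE0 j) * hubbardGridSub L M β (2 * (2 * M)))
          (hubbardGridInteraction L (2 * (2 * M)) β U + hubbardGridCounterQuadratic L (2 * (2 * M)) β K))) m (Sum.inl ∘ k) =
      kernel ℂ (sectorPreimage β F (klEffectiveAction L M β U μ K klE0 j)) m k := by
  haveI : NeZero (2 * (2 * M) : ℕ) := ⟨by have := NeZero.ne M; omega⟩
  rw [kernel_map_fromRows_inl, klEffectiveAction_eq_map_hubbardGridSub (N := 2 * (2 * M)) hβ U μ K klE0 j (by omega) (by omega),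
    sectorPreimage_map_eq_map_mul]

omit [NeZero M] in
/-- **The spectator legs of the spectator vertex are the grid legs of `W_j[K]`** (any spectator family): `kernel_m (Ψ_p W_j[K]) (inr ∘ a) = kernel_m (W_j[K]) (p ∘ a)`. -/
theorem kernel_gridSpectatorFamilyVertex_inr (β U μ : ℝ) (K : TrigPolyC4v) (j : ℕ) (F : Fin N → FreqMomentum L M → ℂ)
    (p : ρ → GridLeg (GridPoint L (2 * (2 * M)))) (m : ℕ) (a : Fin m → ρ) :
    kernel ℂ (ExteriorAlgebra.map (Matrix.toLin' (Matrix.fromRows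
          ((((imagTimeWeight β M : ℝ) : ℂ)) • sectorAnalysisMatrix L M β F * hubbardGridSub L M β (2 * (2 * M)))
          (Matrix.of fun b q => if p b = q then (1 : ℂ) else 0)))
        (effAction ℂ ((hubbardGridSub L M β (2 * (2 * M))).transpose *
            hubbardCovAboveCT L M β μ 0 K (klScale klE0 j) * hubbardGridSub L M β (2 * (2 * M)))
          (hubbardGridInteraction L (2 * (2 * M)) β U + hubbardGridCounterQuadratic L (2 * (2 * M)) β K))) m (Sum.inr ∘ a) =
      kernel ℂ (effAction ℂ ((hubbardGridSub L M β (2 * (2 * M))).transpose *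
            hubbardCovAboveCT L M β μ 0 K (klScale klE0 j) * hubbardGridSub L M β (2 * (2 * M)))
          (hubbardGridInteraction L (2 * (2 * M)) β U + hubbardGridCounterQuadratic L (2 * (2 * M)) β K)) m (p ∘ a) :=
  kernel_map_fromRows_spectator_inr ℂ _ p _ m a

omit [NeZero M] in
/-- **No kernel of the spectator vertex carries one spectator twice** (any family; with `p` injective: no grid leg twice among the plain legs). -/
theorem kernel_gridSpectatorFamilyVertex_eq_zero_of_repeat (β U μ : ℝ) (K : TrigPolyC4v) (j : ℕ) (F : Fin N → FreqMomentum L M → ℂ)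
    (p : ρ → GridLeg (GridPoint L (2 * (2 * M)))) (m : ℕ) (Z : Fin m → (SpaceTimeIdx L M × SectorLeg N) ⊕ ρ) {i i' : Fin m} (hii' : i ≠ i')
    {b : ρ} (hi : Z i = Sum.inr b) (hi' : Z i' = Sum.inr b) :
    kernel ℂ (ExteriorAlgebra.map (Matrix.toLin' (Matrix.fromRows
          ((((imagTimeWeight β M : ℝ) : ℂ)) • sectorAnalysisMatrix L M β F * hubbardGridSub L M β (2 * (2 * M)))
          (Matrix.of fun b q => if p b = q then (1 : ℂ) else 0)))
        (effAction ℂ ((hubbardGridSub L M β (2 * (2 * M))).transpose *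
            hubbardCovAboveCT L M β μ 0 K (klScale klE0 j) * hubbardGridSub L M β (2 * (2 * M)))
          (hubbardGridInteraction L (2 * (2 * M)) β U + hubbardGridCounterQuadratic L (2 * (2 * M)) β K))) m Z = 0 :=
  kernel_map_fromRows_eq_zero_of_spectator_repeat ℂ _ p _ m Z hii' hi hi'

/-! ## The weight on the enlarged label set -/

/-- **The scale-`n` weight on the enlarged label set is a tree weight** (`0 ≤ β`): sector legs are placed by `latticeLegPos`, spectators by the grid position of their
pin, `S ↦ klScaleWt L M β n (S.image (Sum.elim (latticeLegPos 4M) (gridLegPos ∘ p)))`. -/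
theorem isTreeWeight_klScaleWt_spectator [DecidableEq ρ] {Ns : ℕ} {β : ℝ} (hβ : 0 ≤ β) (n : ℕ) (p : ρ → GridLeg (GridPoint L (2 * (2 * M)))) :
    IsTreeWeight (fun S : Finset ((SpaceTimeIdx L M × SectorLeg Ns) ⊕ ρ) =>
      klScaleWt L M β n (S.image (Sum.elim (latticeLegPos (2 * (2 * M))) (fun b => gridLegPos (p b))))) :=
  (isTreeWeight_klScaleWt L M hβ n).comap _

omit [NeZero L] [NeZero M] in
/-- On an all-spectator string the enlarged weight is the weight of the grid string `p ∘ a` (the slot of `twoLegGridMomentsAt_of_wtIncrements`):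
`(univ.image (inr ∘ a)).image (Sum.elim ℓ (gridLegPos ∘ p)) = (univ.image (p ∘ a)).image gridLegPos`. -/
theorem image_sumElim_inr_comp [DecidableEq ρ] {Ns : ℕ} (p : ρ → GridLeg (GridPoint L (2 * (2 * M)))) {m : ℕ} (a : Fin m → ρ) :
    ((univ : Finset (Fin m)).image (Sum.inr ∘ a : Fin m → (SpaceTimeIdx L M × SectorLeg Ns) ⊕ ρ)).image
        (Sum.elim (latticeLegPos (2 * (2 * M))) (fun b => gridLegPos (p b))) =
      ((univ : Finset (Fin m)).image (p ∘ a)).image gridLegPos := by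
  rw [Finset.image_image, Finset.image_image]
  rfl

omit [NeZero L] [NeZero M] in
/-- On an all-sector string the enlarged weight is the tower's weight: `(univ.image (inl ∘ k)).image (Sum.elim (latticeLegPos 4M) g) = (univ.image k).image (latticeLegPos 4M)`. -/
theorem image_sumElim_inl_comp [DecidableEq ρ] {Ns : ℕ} (p : ρ → GridLeg (GridPoint L (2 * (2 * M)))) {m : ℕ} (k : Fin m → SpaceTimeIdx L M × SectorLeg Ns) :
    ((univ : Finset (Fin m)).image (Sum.inl ∘ k : Fin m → (SpaceTimeIdx L M × SectorLeg Ns) ⊕ ρ)).image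
        (Sum.elim (latticeLegPos (2 * (2 * M))) (fun b => gridLegPos (p b))) =
      ((univ : Finset (Fin m)).image k).image (latticeLegPos (2 * (2 * M))) := by
  rw [Finset.image_image, Finset.image_image]
  rfl

end Model

end Summit.HubbardSuperconductivity.HubbardSuperconductivity.Theorems.EngineV8

end
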